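import Summits.CriticalPhenomena.PercolationContinuityZ3.Theorems.PercNearOneGluingAdditiveGluingBhkMenu
import Summits.CriticalPhenomena.PercolationContinuityZ3.Theorems.PercNearOneGluingAdditiveGluingBhkSets
import HarnessLib

/-! # Crux `PercNearOneGluing.AdditiveGluing` (stmt-CriticalPhenomena-4576), line `starglue/tieline`
— stub `stub_crossAllOneTwo_c7` (BHK Thm. 1.4, one source point against two, "ALL" on the `b` side)

Helper file for the crux skeleton of the line `starglue/tieline` (lead
prover-line-stmt-CriticalPhenomena-4576-c7-0): proves exactly the registered stub signature
`stub_crossAllOneTwo_c7`; lands with `--supports stmt-CriticalPhenomena-4576`.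

## Content

Finite weighted graph on `Fin n` (`μ = prodBernoulli w` on `BondConfig (Fin n)`, events
`{x ↔ y} = openConn x y`), a source point `s`, two further points `x, y` with `s ≠ x`, `s ≠ y`,
targets `o, b`, and the decreasing separation event `N := {s ↮ x} ∩ {s ↮ y} = {{s} ↮ {x, y}}`.  Then

`μ(N) · μ(N ∩ {s ↔ o} ∩ ({x ↔ b} ∩ {y ↔ b})) ≤ μ(N ∩ {s ↔ o}) · μ(N ∩ ({x ↔ b} ∩ {y ↔ b}))`.

This is van den Berg–Häggström–Kahn (2006) Thm. 1.4 — given `{S ↮ S'}`, increasing functions of the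
open edge cluster `C_S` and of `C_{S'}` are negatively correlated — for `S = {s}`, `S' = {x, y}`,
`f = 1{o ∈ C_S}` and `g = 1{∀ t ∈ S', t ↔ b}` (the "ALL" literal).  It is the instance of the menu lemma
`bhkMenu_two` (file `…BhkMenu`) with the up-sets `{C | s ↔ o in C}` (`bhkMenu_pt_isUpperSet`,
`bhkMenu_pt_mem`) and `{C | ∀ t ∈ {x, y}, t ↔ b in C}` (`bhkMenu_all_isUpperSet`, `bhkMenu_all_mem`),
the general two-set BHK inequality being the second component of the landed `stub_bhkSets`
(file `…BhkSets`); finally `{{s} ↮ {x, y}}` is rewritten as `{s ↮ x} ∩ {s ↮ y}` and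
`⋂_{t ∈ {x, y}} {t ↔ b}` as `{x ↔ b} ∩ {y ↔ b}`.
-/

namespace Summit.CriticalPhenomena.PercolationContinuityZ3.Theorems

open MeasureTheory Set Literature.Probability.LatticeModels Literature.Probability.Percolation

noncomputable section
open Classical

/-- **BHK 2006 Thm. 1.4 for `C_{{s}}` against `C_{{x, y}}` given `{s ↮ x} ∩ {s ↮ y}`, with
`f = 1{s ↔ o}` and `g = 1{x ↔ b}·1{y ↔ b}` (the "ALL" form on the `b` side):**
`μ(N) μ(N ∩ {s ↔ o} ∩ ({x ↔ b} ∩ {y ↔ b})) ≤ μ(N ∩ {s ↔ o}) μ(N ∩ ({x ↔ b} ∩ {y ↔ b}))`,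
`N = {s ↮ x} ∩ {s ↮ y}` (fed by the second half of the landed `stub_bhkSets` through `bhkMenu_two`).
[cite: VandenbergHaggstromKahn2005, Thm. 1.4 (p. 7)] -/
theorem stub_crossAllOneTwo_c7 : ∀ (n : ℕ) (w : Sym2 (Fin n) → unitInterval) (s x y o b : Fin n), s ≠ x → s ≠ y → (prodBernoulli w).real ((openConn s x)ᶜ ∩ (openConn s y)ᶜ) * (prodBernoulli w).real ((openConn s x)ᶜ ∩ (openConn s y)ᶜ ∩ (openConn s o ∩ (openConn x b ∩ openConn y b))) ≤ (prodBernoulli w).real ((openConn s x)ᶜ ∩ (openConn s y)ᶜ ∩ openConn s o) * (prodBernoulli w).real ((openConn s x)ᶜ ∩ (openConn s y)ᶜ ∩ (openConn x b ∩ openConn y b)) := by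
  intro n w s x y o b hsx hsy
  -- the separation event `{{s} ↮ {x, y}}` is `{s ↮ x} ∩ {s ↮ y}`
  have hN : {ω : BondConfig (Fin n) | ∀ s' ∈ ({s} : Finset (Fin n)), ∀ x' ∈ ({x, y} : Finset (Fin n)),
      ¬ (openGraph ω).Reachable s' x'} = (openConn s x)ᶜ ∩ (openConn s y)ᶜ := by
    ext ω
    simp only [Set.mem_setOf_eq, Finset.mem_singleton, Finset.mem_insert, forall_eq_or_imp, forall_eq,
      Set.mem_inter_iff, Set.mem_compl_iff, openConn]
  have hdisj : Disjoint ({s} : Finset (Fin n)) {x, y} := by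
    rw [Finset.disjoint_singleton_left, Finset.mem_insert, Finset.mem_singleton, not_or]
    exact ⟨hsx, hsy⟩
  have key := bhkMenu_two stub_bhkSets.2 w {s} {x, y}
    {C : Set (Sym2 (Fin n)) | (openGraph C).Reachable s o}
    {C : Set (Sym2 (Fin n)) | ∀ t ∈ ({x, y} : Finset (Fin n)), (openGraph C).Reachable t b}
    (bhkMenu_pt_isUpperSet s o) (bhkMenu_all_isUpperSet {x, y} b)
    (openConn s o) (openConn x b ∩ openConn y b)
    (fun ω => bhkMenu_pt_mem {s} (Finset.mem_singleton_self s) o ω)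
    (fun ω => by
      rw [bhkMenu_all_mem, Finset.set_biInter_insert, Finset.set_biInter_singleton])
    hdisj
  rw [hN] at key
  exact key

end

end Summit.CriticalPhenomena.PercolationContinuityZ3.Theorems
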